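import Literature.MathematicalPhysics.QuantumFieldTheory.Balaban1983to89.B9Thm311SitePrimeFormCoerciveBlockGauge
import Literature.MathematicalPhysics.QuantumFieldTheory.Balaban1983to89.B7Eq44TorusAxialGaugeLocal
import Literature.MathematicalPhysics.QuantumFieldTheory.Balaban1983to89.B9Eq384RemainderLetters
import Literature.MathematicalPhysics.QuantumFieldTheory.Balaban1983to89.B9Thm311SmallFieldClosed

/-!
# `Balaban1983to89.B9Thm311SitePrimeFormCoercivePlaquette` — T. Bałaban, *Propagators for lattice gauge theories in a background field*, Commun.
# Math. Phys. **99** (1985) 389–434 [Balaban1985BackgroundPropagators] (3.24) p. 394, p. 395, (3.35) p. 396, Thm 3.11 p. 416, with [Balaban1985Averaging]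
# (44) pp. 24–25 and [Balaban1987RG1] (1.11)–(1.12) p. 262: **[B9] THM 3.11 «Δ′_a IS POSITIVE DEFINITE» FOR THE SITE OPERATOR AT PRINT's PLAQUETTE
# CLASS, STRONGLY, WITH CONSTANTS FREE OF `η, m, L, c₀, c₁`** — for every unit-bounded unitary `U` whose plaquette variables are `δ`-close to `1`,
# `(1∕(3 + 4∕a′))·(‖D_Uλ‖² + (1 − κ)(ηL)⁻²‖λ‖²) ≤ re⟨λ, Δ′_{a′}(U)λ⟩`, `κ = 2d(L−1)L·ε² + 4ρ′(ε)²`, `ε = 2M_φM_φ′·d(L−1)·δ`; along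
# `c₁(ηL)² = c₀L^d`, `0 < ηL ≤ 1`, `δ ≤ α₀η²`: `κ ≤ κ₀ = 8d³A² + 4(2d²A·e^{2d²A})²`, `A = M_φM_φ′α₀` — NO closed coordinate line, NO global bond
# window: the gauges of `B9Thm311SitePrimeFormCoerciveBlockGauge` PRODUCED block by block by the LOCAL axial gauge (R2′ STEP B8′ (v) «Tier P»)

statement-level skeleton of published theorems with citation tags; proofs where landed; nothing here is a claim about the Yang–Mills mass gap

PDF held: `paper:balaban1985-cmp99-background-propagators` pp. 394–396, 416; `paper:balaban1985-cmp98-averaging` pp. 24–25; `paper:balaban1987-cmp109-rg-i-small-field`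
p. 262 — via the quotations of `B7Eq44TorusAxialGaugeLocal`, `B9Thm311SmallPlaquettes`, `B9Thm311DeltaPrimeA` (this lineage and the NE9 owner's).
THE PRINT (verbatim): [B9] (3.35) p. 396 *«there exists a gauge transformation u on □ such that U^u = e^{iηA} … |A| … ≤ O(1)Mα₀»*; Thm 3.11 p. 416
*«Δ′_a, G′, (Q′G′²Q′*)⁻¹, Δ_a, G are positive definite»*, proof *«… reduced to a proof of positivity of the operators G_□ … Doing the gauge transformation we
get U = e^{iηA} with A small»*; p. 395 *«it can be easily shown that the operator Δ′_a is positive»*; [B7] p. 25 and [I] (1.12) p. 262 as quoted in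
`B7Eq44TorusAxialGaugeLocal` («|V₀,b − 1| < |b₋ − y|α₀ ≦ dLα₀ … a local result»; «for each cube □ … a gauge transformation u defined on □»).
WHY THIS FILE (cell context).  ROUTES-NE9 v13.21 §L1.2 l.413 (v)∕(x) «the PLAQUETTE-CLASS upgrade of (I1)» (offered to this lineage first): the gen-61
`B9Thm311SmallPlaquettes` reaches Thm 3.11 at the plaquette class only through the GLOBAL small-bond orbit (closed coordinate lines needed — the
trivial-holonomy sector; volume-dependent `δ`).  For the SITE operator the p. 416 locality reduction runs block by block (`B9Thm311SitePrimeFormCoerciveBlockGauge`);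
here its displayed block gauges are PRODUCED — `g y :=` the axial gauge of `B7Eq44TorusAxialGaugeLocal` rooted at the centre of `B(y)` (box `[0, L−1]^d`, LINEAR
count `d(L−1)δ`) —, `hAd` from unitarity in the tracial norming (`inner_AdW_AdW_of_compat`), `ε = 2M_φM_φ′d(L−1)δ` from `norm_adTransportW_sub_le`, `hRS` from
`hRS_of_unitary`.  THE η-COUNT: with `δ ≤ α₀η²`, `(L−1)L·ε² ≤ 4d²(M_φM_φ′α₀)²(ηL)⁴` — the `η⁻²` of the Poincaré constant is absorbed by the linear count on ONE block.
WHAT IS PROVED (sorry-free; 0 `def`; [folklore] lattice arithmetic + composition of the tree's theorems).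
* §1 `val_sub_centre`, `liftSite_sub_centre` (`(x − centre(blockCoord x))~ = (x_i mod L)_i`), **`offset_succ_lt_of_blockCoord_shift`** (with `2 ≤ m_i`
  an in-block bond never wraps: `x_μ mod L + 1 < L`), **`liftSite_sub_centre_add_e_le`** (an in-block bond is a bond of the box `centre y + [0, L−1]^d`),
  `l1_const_pred` (`|(L−1,…,L−1)|₁ = d(L−1)`).
* §2 `blockGauge_mem_U1`, **`inner_AdW_blockGauge`** (`hAd`), **`norm_adTransportW_blockGauge_sub_le`** (`hR` with `ε = 2M_φM_φ′·d(L−1)·δ`).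
* §3 **`site_strong_coercive_of_small_plaquettes`** — the strong form at every `U` of the class with `κ(ε)` explicit;
  **`site_strong_coercive_of_small_plaquettes_canonical`** — along `c₁(ηL)² = c₀L^d`, `0 < ηL ≤ 1`, `δ ≤ α₀η²`: `κ ≤ κ₀(d, M_φM_φ′α₀)` FREE OF `η, m, L`;
  `site_coercive_of_small_plaquettes_canonical` (the weak `L²` row) and **`laplacePrimeA_pos_of_small_plaquettes`** (`κ₀ < 1 ⇒ 0 < re⟨λ, Δ′_{a′}(U)λ⟩`
  for `λ ≠ 0` — the chain's `hpos′` slot at the plaquette class; `G′` (3.25) exists); **`exists_site_strong_coercive_of_small_plaquettes`** —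
  the (SC) shape `∃ A₁ γ > 0` BEFORE `∀ L m U δ η c₀ c₁ α₀`: `γ·(‖D_Uλ‖² + (ηL)⁻²‖λ‖²) ≤ re⟨λ, Δ′_{a′}(U)λ⟩` whenever `M_φM_φ′α₀ ≤ A₁(d)`.
MODEL ∕ DECLARED READINGS.  (M1) the E162∕NE9 chain's encodings verbatim (`laplacePrimeA`, `QprimeW`, `covDerivL2K`, `gaugeU`, `axialGaugeTAt`); fibre
read along `φ` with `‖φ‖ ≤ M_φ`, `‖φ⁻¹‖ ≤ M_φ′`, tracial norming `⟨φ⁻¹X, φ⁻¹Y⟩ = τ(X*Y)`; (M2) hypotheses: `U(b) ∈ U1`, `U(b)* = U(b)⁻¹`, ALL plaquettes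
`δ`-close to `1`, and **`2 ≤ m_i`** (at least two blocks per direction: with one block the `blockCoord` test counts the wrapping bond as internal and its
gauged value is a closed line — flagged, not hidden; print's cube sits inside a large lattice); NO closed line, NO `L·m_i ≤ N`, NO `ε ≤ ε₃`;
(M3) constants explicit; NOT HERE: `G′`, (3.63)–(3.64), the bond operator `Δ_a` and its non-local `R` (S-P6′), sup-norms, the tower.
HONEST SCOPE.  Composition of landed theorems + block arithmetic; form-level positivity of the SITE operator only; «NE9 ⇐ the named binders»; NE9 NOT
PRINTED ∕ NOT PROVED; NOT summit progress (cell pub-balaban: spine PROVED 0/9; rung (B)+1 finite T⁴ — NOT infinite volume, NOT mass gap, NOT Clay; HONEST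
DEPENDENCY: continuum YM on T⁴ ⇐ BetaPertH ∧ nine spine estimates (0/9 proved); BetaPertH ⇐ (D1) ∧ (D4) ∧ CAP+tail; G-an2-4 gates asym, D1 and NE2/3/4).
Unit `b2b-balaban-t4-ne9-formalise-leaf-03` (NE9 crux-team leaf prover, gen 63), INTENT I-ne9leaf03-g63-1 part (P2); NEW file; modifies nothing.  Net new
unproved facts: 0.
-/

noncomputable section

open scoped BigOperators InnerProductSpace ComplexConjugate

namespace Literature.MathematicalPhysics.QuantumFieldTheory.Balaban1983to89.B9Thm311SitePrimeFormCoercivePlaquette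

open B4Sect5Torus (TSite)
open B9SectCLatticeCarrier (Bond shift shift_apply_val)
open B7Prop1Explicit (U1 e e_apply l1)
open B9Eq319QprimeTorus (fineP centre blockCoord offset offset_lt centre_apply_val blockCoord_apply_val)
open B9Eq315QTorusOnto (liftSite)
open B11Eq103H1Complex (SiteL2K covDerivL2K)
open B9Eq310HessianOperator (adTransportW)
open B9Eq310DeltaPrime (plaqHolU)
open B9Eq3119DeltaPiCarrier (laplacePrimeA)
open B9Eq328GaugeAction (gaugeU gaugeU_apply_dir AdW AdA tau_AdA_of_trace inner_AdW_AdW_of_compat)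
open B7Eq44TorusAxialGaugeLocal (axialGaugeTAt axialGaugeTAt_mem_U1 star_axialGaugeTAt norm_gaugeU_axialGaugeTAt_sub_one_le_uniform)
open B9Eq384RemainderLetters (norm_adTransportW_sub_le)
open B9Thm311SmallFieldClosed (hRS_of_unitary)
open B9Thm311SitePrimeFormCoerciveBlockGauge (site_strong_coercive_blockGauge)
open B9Eq319QprimeLipschitz (rho_nonneg rho_le)

variable {d : ℕ} (L : ℕ) [NeZero L] (m : Fin d → ℕ)

/-! ## §1 In-block bonds are bonds of the box `centre y + [0, L−1]^d` -/

section Arith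
/-- For a fine site `x`, the torus difference `x − centre(blockCoord x)` has coordinates `x_i mod L` (no wrap: `L·(x_i div L) ≤ x_i`).
[cite: Balaban1985Averaging, (2) p.17] -/
theorem val_sub_centre (x : TSite d (fineP L m)) (i : Fin d) :
    ((x - centre L m (blockCoord L m x)) i : ℕ) = offset L m x i := by
  have hle : centre L m (blockCoord L m x) i ≤ x i := by
    rw [Fin.le_def]
    show L * ((x i : ℕ) / L) ≤ (x i : ℕ)
    exact Nat.mul_div_le _ _
  rw [Pi.sub_apply, Fin.coe_sub_iff_le.2 hle]
  show (x i : ℕ) - L * ((x i : ℕ) / L) = (x i : ℕ) % L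
  exact Nat.sub_eq_of_eq_add (Nat.mod_add_div _ _).symm
/-- The representative of `x − centre(blockCoord x)` is the offset vector `(x_i mod L)_i ∈ [0, L−1]^d`. [cite: Balaban1985Averaging, (2) p.17] -/
theorem liftSite_sub_centre (x : TSite d (fineP L m)) :
    liftSite (x - centre L m (blockCoord L m x)) = fun i => ((offset L m x i : ℕ) : ℤ) := by
  funext i
  simp only [liftSite, val_sub_centre]
/-- **WITH AT LEAST TWO BLOCKS PER DIRECTION AN IN-BLOCK BOND NEVER WRAPS**: if `x` and `x + e_μ` lie in the same block then `x_μ mod L + 1 < L`.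
(With ONE block the bond `x_μ = L − 1 → 0` wraps around the torus and passes the `blockCoord` test — excluded here by `2 ≤ m_μ`.)
[cite: Balaban1985Averaging, (2) p.17, p.25] -/
theorem offset_succ_lt_of_blockCoord_shift (hm : ∀ i, 2 ≤ m i) {x : TSite d (fineP L m)} {μ : Fin d}
    (h : blockCoord L m (shift μ x) = blockCoord L m x) : offset L m x μ + 1 < L := by
  have hL : 0 < L := Nat.pos_of_ne_zero (NeZero.ne L)
  have hμ := congrArg (fun f : TSite d m => ((f μ : ℕ))) h
  simp only [blockCoord_apply_val, shift_apply_val] at hμ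
  set v : ℕ := (x μ : ℕ) with hv
  have hvP : v < L * m μ := (x μ).isLt
  have hdm : v = v % L + L * (v / L) := (Nat.mod_add_div v L).symm
  have hrL : v % L < L := Nat.mod_lt _ hL
  show v % L + 1 < L
  by_contra hr
  have hr' : v % L + 1 = L := by omega
  rcases Nat.lt_or_ge (v + 1) (L * m μ) with hlt | hge
  · -- no wrap around the torus: `(v+1)/L = v/L + 1`
    have h1 : (v + 1) % (L * m μ) = v + 1 := Nat.mod_eq_of_lt hlt
    have h2 : v + 1 = L * (v / L + 1) := by rw [mul_add, mul_one]; omega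
    have h3 : (v + 1) / L = v / L + 1 := by rw [h2, Nat.mul_div_cancel_left _ hL]
    have h4 : (v + 1) % (fineP L m μ) / L = v / L := hμ
    rw [show fineP L m μ = L * m μ from rfl, h1, h3] at h4
    omega
  · -- wrap: `v + 1 = L·m_μ ≥ 2L` but `v / L = 0`
    have h1 : v + 1 = L * m μ := le_antisymm hvP hge
    have h2 : (v + 1) % (fineP L m μ) = 0 := by rw [show fineP L m μ = L * m μ from rfl, h1, Nat.mod_self]
    have h4 : (v + 1) % (fineP L m μ) / L = v / L := hμ
    rw [h2, Nat.zero_div] at h4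
    have h5 : v < L := Nat.lt_of_div_eq_zero hL h4.symm
    have h6 : 2 * L ≤ L * m μ := by rw [mul_comm]; exact Nat.mul_le_mul_left _ (hm μ)
    omega
/-- **AN IN-BLOCK BOND IS A BOND OF THE BOX `centre y + [0, L−1]^d`** (the hypothesis `liftSite (x − x₀) + e_μ ≤ n` of
`B7Eq44TorusAxialGaugeLocal` with `x₀ = centre y`, `n = (L−1, …, L−1)`), given `2 ≤ m_i`. [cite: Balaban1985Averaging, (2) p.17, p.25; Balaban1987RG1, (1.12) p.262] -/
theorem liftSite_sub_centre_add_e_le (hm : ∀ i, 2 ≤ m i) {y : TSite d m} {x : TSite d (fineP L m)} {μ : Fin d}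
    (hx : blockCoord L m x = y) (hxμ : blockCoord L m (shift μ x) = y) :
    liftSite (x - centre L m y) + e μ ≤ fun _ : Fin d => ((L : ℤ) - 1) := by
  subst hx
  have hwrap := offset_succ_lt_of_blockCoord_shift L m hm hxμ
  rw [liftSite_sub_centre]
  intro i
  simp only [Pi.add_apply, e_apply]
  have hi := offset_lt L m x i
  split_ifs with h
  · subst h; omega
  · omega
omit [NeZero L] in
/-- `|(L−1, …, L−1)|₁ = d·(L−1)`. [cite: Balaban1985Averaging, p.25] -/
theorem l1_const_pred (hL : 1 ≤ L) : (l1 (fun _ : Fin d => ((L : ℤ) - 1)) : ℝ) = d * ((L : ℝ) - 1) := by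
  have h1 : ((L : ℤ) - 1) = ((L - 1 : ℕ) : ℤ) := by push_cast [Nat.cast_sub hL]; ring
  have h2 : l1 (fun _ : Fin d => ((L : ℤ) - 1)) = d * (L - 1) := by
    unfold l1
    simp only [h1, Int.natAbs_natCast, Finset.sum_const, Finset.card_univ, Fintype.card_fin, smul_eq_mul]
  rw [h2, Nat.cast_mul, Nat.cast_sub hL, Nat.cast_one]

end Arith

/-! ## §2 The block gauges and their letters -/

section Gauges

variable [∀ i, NeZero (fineP L m i)] {𝔸 : Type*} [NormedRing 𝔸] [NormedAlgebra ℂ 𝔸] [NormOneClass 𝔸] [StarRing 𝔸]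
  {W : Type*} [NormedAddCommGroup W] [InnerProductSpace ℂ W] (φ : W ≃ₗ[ℂ] 𝔸) (τ : 𝔸 →ₗ[ℂ] ℂ)
  {Mφ Mφ' : ℝ} (hφ : ∀ w, ‖φ w‖ ≤ Mφ * ‖w‖) (hφ' : ∀ X, ‖φ.symm X‖ ≤ Mφ' * ‖X‖) (hMφ' : 0 ≤ Mφ')
  (hτφ : ∀ X Y : 𝔸, ⟪φ.symm X, φ.symm Y⟫_ℂ = τ (star X * Y)) (htr : ∀ X Y : 𝔸, τ (X * Y) = τ (Y * X))
  (hm : ∀ i, 2 ≤ m i) {U : Bond d (fineP L m) → 𝔸ˣ} (hU : ∀ b, U b ∈ U1 𝔸) (hUstar : ∀ b, star (U b : 𝔸) = (((U b)⁻¹ : 𝔸ˣ) : 𝔸))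
  {δ : ℝ} (hδ0 : 0 ≤ δ) (hδ : ∀ p : B9SectCLatticeCarrier.Plaq d (fineP L m), ‖(plaqHolU U p : 𝔸) - 1‖ ≤ δ)
omit [NeZero L] [NormedAlgebra ℂ 𝔸] [StarRing 𝔸] in
include hU in
/-- The gauged field `U^{g}` of a unit-bounded `U` by the rooted axial gauge is unit-bounded on every bond. [cite: Balaban1985Averaging, p.24; Balaban1985BackgroundPropagators, (3.28) p.395] -/
theorem blockGauge_mem_U1 (x₀ : TSite d (fineP L m)) (b : Bond d (fineP L m)) : gaugeU (axialGaugeTAt (fineP L m) U x₀) U b ∈ U1 𝔸 := by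
  obtain ⟨x, μ⟩ := b
  rw [gaugeU_apply_dir]
  exact (U1 𝔸).mul_mem ((U1 𝔸).mul_mem (axialGaugeTAt_mem_U1 _ hU _ _) (hU _)) ((U1 𝔸).inv_mem (axialGaugeTAt_mem_U1 _ hU _ _))
omit [NeZero L] [NormOneClass 𝔸] in
include hτφ htr hUstar in
/-- **`hAd` FOR THE BLOCK GAUGES**: `R(g y x)` is a fibrewise isometry — the rooted axial gauge of a unitary field is unitary (`star_axialGaugeTAt`),
`τ` is tracial, the norming is `τ(X*Y)`. [cite: Balaban1985BackgroundPropagators, (3.30)–(3.31) p.395; Balaban1985Averaging, (18) p.21] -/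
theorem inner_AdW_blockGauge (x₀ x : TSite d (fineP L m)) (v v' : W) :
    ⟪AdW φ (axialGaugeTAt (fineP L m) U x₀ x) v, AdW φ (axialGaugeTAt (fineP L m) U x₀ x) v'⟫_ℂ = ⟪v, v'⟫_ℂ :=
  inner_AdW_AdW_of_compat φ τ hτφ (fun X => tau_AdA_of_trace τ htr _ X) (star_axialGaugeTAt (fineP L m) x₀ hUstar x) v v'
omit [StarRing 𝔸] in
include hφ hφ' hMφ' hm hU hδ0 hδ in
/-- **`hR` FOR THE BLOCK GAUGES — (3.35) ON EVERY BLOCK FROM THE PLAQUETTES**: in the axial gauge rooted at the centre of `B(y)`, every IN-BLOCK bond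
`(x, μ)` (`x, x + e_μ ∈ B(y)`; `2 ≤ m_i`) has its transporter `ε`-close to the identity on the fibre, `ε = 2M_φM_φ′·d(L−1)·δ`
(`B7Eq44TorusAxialGaugeLocal.norm_gaugeU_axialGaugeTAt_sub_one_le_uniform`: `‖U^{g y}(x,μ) − 1‖ ≤ d(L−1)δ`; `B9Eq384RemainderLetters.norm_adTransportW_sub_le`).
[cite: Balaban1985BackgroundPropagators, (3.35) p.396, Thm 3.11 p.416; Balaban1985Averaging, pp.24–25; Balaban1987RG1, (1.12) p.262] -/
theorem norm_adTransportW_blockGauge_sub_le (y : TSite d m) (x : TSite d (fineP L m)) (μ : Fin d) (hx : blockCoord L m x = y)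
    (hxμ : blockCoord L m (shift μ x) = y) (w : W) :
    ‖adTransportW φ (gaugeU (axialGaugeTAt (fineP L m) U (centre L m y)) U) (x, μ) w - w‖ ≤ 2 * Mφ * Mφ' * (d * ((L : ℝ) - 1) * δ) * ‖w‖ := by
  have hL : 1 ≤ L := Nat.one_le_iff_ne_zero.2 (NeZero.ne L)
  have hn : ∀ i, (fun _ : Fin d => ((L : ℤ) - 1)) i + 1 ≤ (fineP L m i : ℕ) := fun i => by
    have h2 : 1 ≤ m i := le_trans (by norm_num) (hm i)
    have h3 : (L : ℤ) * 1 ≤ (L : ℤ) * (m i : ℤ) := mul_le_mul_of_nonneg_left (by exact_mod_cast h2) (by positivity)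
    show ((L : ℤ) - 1) + 1 ≤ ((L * m i : ℕ) : ℤ)
    push_cast; linarith
  have hδ' : ∀ (x : TSite d (fineP L m)) (κ μ : Fin d) (hκμ : κ < μ),
      liftSite (x - centre L m y) + e κ + e μ ≤ (fun _ : Fin d => ((L : ℤ) - 1)) → ‖(plaqHolU U (x, ⟨(κ, μ), hκμ⟩) : 𝔸) - 1‖ ≤ δ :=
    fun x κ μ hκμ _ => hδ _
  have hbond := norm_gaugeU_axialGaugeTAt_sub_one_le_uniform (fineP L m) hU (centre L m y) hn hδ' hδ0 x μ
    (liftSite_sub_centre_add_e_le L m hm hx hxμ)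
  rw [l1_const_pred L hL] at hbond
  exact norm_adTransportW_sub_le φ hφ hφ' hMφ' _ (x, μ) (blockGauge_mem_U1 L m hU _ _) hbond w

end Gauges

/-! ## §3 Thm 3.11 for the site operator at the plaquette class -/

section Thm311

variable [∀ i, NeZero (fineP L m i)] {𝔸 : Type*} [NormedRing 𝔸] [NormedAlgebra ℂ 𝔸] [NormOneClass 𝔸] [StarRing 𝔸]
  {W : Type*} [NormedAddCommGroup W] [InnerProductSpace ℂ W] [FiniteDimensional ℂ W] (φ : W ≃ₗ[ℂ] 𝔸) {c₀ c₁ : ℝ} [Fact (0 < c₀)] [Fact (0 < c₁)]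
  (τ : 𝔸 →ₗ[ℂ] ℂ) {Mφ Mφ' : ℝ} (hMφ : 0 ≤ Mφ) (hMφ' : 0 ≤ Mφ') (hφ : ∀ w, ‖φ w‖ ≤ Mφ * ‖w‖) (hφ' : ∀ X, ‖φ.symm X‖ ≤ Mφ' * ‖X‖)
  (hτφ : ∀ X Y : 𝔸, ⟪φ.symm X, φ.symm Y⟫_ℂ = τ (star X * Y)) (htr : ∀ X Y : 𝔸, τ (X * Y) = τ (Y * X))
  (hm : ∀ i, 2 ≤ m i) {U : Bond d (fineP L m) → 𝔸ˣ} (hU : ∀ b, U b ∈ U1 𝔸) (hUstar : ∀ b, star (U b : 𝔸) = (((U b)⁻¹ : 𝔸ˣ) : 𝔸))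
  {δ : ℝ} (hδ0 : 0 ≤ δ) (hδ : ∀ p : B9SectCLatticeCarrier.Plaq d (fineP L m), ‖(plaqHolU U p : 𝔸) - 1‖ ≤ δ)
  {η : ℝ} (hη : η ≠ 0) {a' : ℝ} (ha' : 0 < a') (hηL0 : 0 < η * L) (hs : c₁ * (η * L) ^ 2 = c₀ * (L : ℝ) ^ d)
include hMφ hMφ' hφ hφ' hτφ htr hm hU hUstar hδ0 hδ hη ha' hηL0 hs in
/-- **[B9] THM 3.11 FOR THE SITE OPERATOR `Δ′_{a′}(U)` AT THE PLAQUETTE CLASS, STRONG FORM, EXPLICIT LETTERS**: for unit-bounded unitary `U` on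
`T_{L·m}` (`2 ≤ m_i`) with `‖U(∂p) − 1‖ ≤ δ` for all plaquettes, along `c₁(ηL)² = c₀L^d`, `0 < ηL`, `a′ > 0`:
`(1∕(3 + 4∕a′))·(‖D_Uλ‖² + (1 − κ)(ηL)⁻²‖λ‖²) ≤ re⟨λ, Δ′_{a′}(U)λ⟩`, `κ = 2d(L−1)L·ε² + 4((1 + ε)^{d(L−1)} − 1)²`, `ε = 2M_φM_φ′·d(L−1)·δ` —
`B9Thm311SitePrimeFormCoerciveBlockGauge.site_strong_coercive_blockGauge` with the block gauges of §2 and `hRS_of_unitary`.  No closed line, no global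
bond window, every flat sector. [cite: Balaban1985BackgroundPropagators, (3.24) p.394, p.395, (3.35) p.396, Thm 3.11 p.416; Balaban1987RG1, (1.11)–(1.12) p.262] -/
theorem site_strong_coercive_of_small_plaquettes (lam : SiteL2K ℂ d (fineP L m) c₀ W) :
    (1 / (3 + 4 / a')) * (‖covDerivL2K ℂ c₀ ((η : ℂ))⁻¹ (adTransportW φ U) lam‖ ^ 2 +
        (1 - (2 * d * (((L : ℝ) - 1) * L) * (2 * Mφ * Mφ' * (d * ((L : ℝ) - 1) * δ)) ^ 2 +
          4 * ((1 + 2 * Mφ * Mφ' * (d * ((L : ℝ) - 1) * δ)) ^ (d * (L - 1)) - 1) ^ 2)) * (((η * L)⁻¹) ^ 2 * ‖lam‖ ^ 2)) ≤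
      RCLike.re ⟪lam, laplacePrimeA L m φ η U a' (c₁ := c₁) lam⟫_ℂ := by
  have hLr : (1 : ℝ) ≤ L := by exact_mod_cast Nat.one_le_iff_ne_zero.2 (NeZero.ne L)
  have hε : 0 ≤ 2 * Mφ * Mφ' * (d * ((L : ℝ) - 1) * δ) := by
    have : 0 ≤ (L : ℝ) - 1 := by linarith
    positivity
  exact site_strong_coercive_blockGauge L m φ (c₁ := c₁) hη U (hRS_of_unitary φ τ hτφ htr U hUstar)
    (fun y => axialGaugeTAt (fineP L m) U (centre L m y)) (fun y x v v' => inner_AdW_blockGauge L m φ τ hτφ htr hUstar _ x v v') hε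
    (fun y x μ hx hxμ w => norm_adTransportW_blockGauge_sub_le L m φ hφ hφ' hMφ' hm hU hδ0 hδ y x μ hx hxμ w) ha' hηL0 hs lam
set_option maxHeartbeats 400000 in
include hMφ hMφ' hφ hφ' hτφ htr hm hU hUstar hδ0 hδ hη ha' hηL0 hs in
/-- **THE CANONICAL FORM — CONSTANTS FREE OF `η, m, L, c₀, c₁`**: if moreover `ηL ≤ 1` and `δ ≤ α₀η²` (print's plaquette class at lattice spacing `η`),
then with `A := M_φM_φ′α₀` and `κ₀ := 8d³A² + 4(2d²A·e^{2d²A})²`: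
`(1∕(3 + 4∕a′))·(‖D_Uλ‖² + (1 − κ₀)(ηL)⁻²‖λ‖²) ≤ re⟨λ, Δ′_{a′}(U)λ⟩` — `ε ≤ 2dA·η(ηL)`, so `(L−1)Lε² ≤ 4d²A²(ηL)⁴` and
`ρ′ ≤ d(L−1)ε·(1+ε)^{d(L−1)} ≤ 2d²A·e^{2d²A}`: the `η⁻²` of the Poincaré constant is absorbed by the LINEAR axial count on one block.  [B9] Thm 3.11's
first clause for `Δ′_a` at (3.35)'s class with an `O(1)` constant, as print asserts. [cite: Balaban1985BackgroundPropagators, p.395, (3.35) p.396, Thm 3.11 p.416; Balaban1985Averaging, p.25; Balaban1987RG1, (1.12) p.262] -/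
theorem site_strong_coercive_of_small_plaquettes_canonical (hηL1 : η * L ≤ 1) {α₀ : ℝ} (hα₀ : 0 ≤ α₀) (hδα : δ ≤ α₀ * η ^ 2)
    (lam : SiteL2K ℂ d (fineP L m) c₀ W) :
    (1 / (3 + 4 / a')) * (‖covDerivL2K ℂ c₀ ((η : ℂ))⁻¹ (adTransportW φ U) lam‖ ^ 2 +
        (1 - (8 * d ^ 3 * (Mφ * Mφ' * α₀) ^ 2 +
          4 * (2 * d ^ 2 * (Mφ * Mφ' * α₀) * Real.exp (2 * d ^ 2 * (Mφ * Mφ' * α₀))) ^ 2)) * (((η * L)⁻¹) ^ 2 * ‖lam‖ ^ 2)) ≤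
      RCLike.re ⟪lam, laplacePrimeA L m φ η U a' (c₁ := c₁) lam⟫_ℂ := by
  have hmain := site_strong_coercive_of_small_plaquettes L m φ (c₁ := c₁) τ hMφ hMφ' hφ hφ' hτφ htr hm hU hUstar hδ0 hδ hη ha' hηL0 hs lam
  have hL1n : 1 ≤ L := Nat.one_le_iff_ne_zero.2 (NeZero.ne L)
  have hL1 : (1 : ℝ) ≤ L := by exact_mod_cast hL1n
  have hLr : (0 : ℝ) < L := by linarith
  have hL0 : (0 : ℝ) ≤ (L : ℝ) - 1 := by linarith
  have hη0 : 0 < η := (mul_pos_iff_of_pos_right hLr).1 hηL0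
  have hMM : 0 ≤ Mφ * Mφ' := mul_nonneg hMφ hMφ'
  set A := Mφ * Mφ' * α₀ with hA
  have hA0 : 0 ≤ A := mul_nonneg hMM hα₀
  set ε := 2 * Mφ * Mφ' * (d * ((L : ℝ) - 1) * δ) with hεdef
  have hε : 0 ≤ ε := by rw [hεdef]; positivity
  have hε_le : ε ≤ 2 * d * A * (η ^ 2 * L) := by
    have h1 : d * ((L : ℝ) - 1) * δ ≤ d * (L : ℝ) * (α₀ * η ^ 2) := by
      have : d * ((L : ℝ) - 1) * δ ≤ d * ((L : ℝ) - 1) * (α₀ * η ^ 2) := mul_le_mul_of_nonneg_left hδα (by positivity)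
      have : d * ((L : ℝ) - 1) * (α₀ * η ^ 2) ≤ d * (L : ℝ) * (α₀ * η ^ 2) := by
        have : (0 : ℝ) ≤ α₀ * η ^ 2 := by positivity
        nlinarith
      linarith
    calc ε = 2 * (Mφ * Mφ') * (d * ((L : ℝ) - 1) * δ) := by rw [hεdef]; ring
      _ ≤ 2 * (Mφ * Mφ') * (d * (L : ℝ) * (α₀ * η ^ 2)) := mul_le_mul_of_nonneg_left h1 (by positivity)
      _ = 2 * d * A * (η ^ 2 * L) := by rw [hA]; ring
  have ht1 : (η * L) * (η * L) ≤ 1 := mul_le_one₀ hηL1 hηL0.le hηL1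
  have ht4 : (η * L) ^ 4 ≤ 1 := pow_le_one₀ hηL0.le hηL1
  have h1 : 2 * d * (((L : ℝ) - 1) * L) * ε ^ 2 ≤ 8 * d ^ 3 * A ^ 2 := by
    have hεsq : ε ^ 2 ≤ (2 * d * A * (η ^ 2 * L)) ^ 2 := pow_le_pow_left₀ hε hε_le 2
    have hLL : ((L : ℝ) - 1) * L ≤ (L : ℝ) * L := by nlinarith
    calc 2 * d * (((L : ℝ) - 1) * L) * ε ^ 2 ≤ 2 * d * ((L : ℝ) * L) * (2 * d * A * (η ^ 2 * L)) ^ 2 := by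
          gcongr
      _ = 8 * d ^ 3 * A ^ 2 * (η * L) ^ 4 := by ring
      _ ≤ 8 * d ^ 3 * A ^ 2 * 1 := by gcongr
      _ = 8 * d ^ 3 * A ^ 2 := by ring
  have hN : (((d * (L - 1) : ℕ)) : ℝ) = d * ((L : ℝ) - 1) := by rw [Nat.cast_mul, Nat.cast_sub hL1n, Nat.cast_one]
  have hNε : (d * ((L : ℝ) - 1)) * ε ≤ 2 * d ^ 2 * A := by
    calc (d * ((L : ℝ) - 1)) * ε ≤ (d * ((L : ℝ) - 1)) * (2 * d * A * (η ^ 2 * L)) := mul_le_mul_of_nonneg_left hε_le (by positivity)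
      _ = 2 * d ^ 2 * A * ((η * ((L : ℝ) - 1)) * (η * L)) := by ring
      _ ≤ 2 * d ^ 2 * A * ((η * L) * (η * L)) := by
          have : η * ((L : ℝ) - 1) ≤ η * L := by nlinarith
          have : (η * ((L : ℝ) - 1)) * (η * L) ≤ (η * L) * (η * L) := mul_le_mul_of_nonneg_right this hηL0.le
          exact mul_le_mul_of_nonneg_left this (by positivity)
      _ ≤ 2 * d ^ 2 * A * 1 := mul_le_mul_of_nonneg_left ht1 (by positivity)
      _ = 2 * d ^ 2 * A := by ring
  have hNε' : (((d * (L - 1) : ℕ)) : ℝ) * ε ≤ 2 * d ^ 2 * A := by rw [hN]; exact hNε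
  have hpow : (1 + ε) ^ (d * (L - 1)) ≤ Real.exp (2 * d ^ 2 * A) := by
    calc (1 + ε) ^ (d * (L - 1)) ≤ (Real.exp ε) ^ (d * (L - 1)) :=
          pow_le_pow_left₀ (by linarith) (by linarith [Real.add_one_le_exp ε]) _
      _ = Real.exp ((((d * (L - 1) : ℕ)) : ℝ) * ε) := by rw [← Real.exp_nat_mul]
      _ ≤ Real.exp (2 * d ^ 2 * A) := Real.exp_le_exp.2 hNε'
  have hρ0 : 0 ≤ (1 + ε) ^ (d * (L - 1)) - 1 := rho_nonneg L (d := d) hε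
  have h2 : (1 + ε) ^ (d * (L - 1)) - 1 ≤ 2 * d ^ 2 * A * Real.exp (2 * d ^ 2 * A) :=
    (rho_le L (d := d) hε).trans (mul_le_mul hNε' hpow (pow_nonneg (by linarith) _) (by positivity))
  have hκ : 2 * d * (((L : ℝ) - 1) * L) * ε ^ 2 + 4 * ((1 + ε) ^ (d * (L - 1)) - 1) ^ 2 ≤
      8 * d ^ 3 * A ^ 2 + 4 * (2 * d ^ 2 * A * Real.exp (2 * d ^ 2 * A)) ^ 2 :=
    add_le_add h1 (mul_le_mul_of_nonneg_left (pow_le_pow_left₀ hρ0 h2 2) (by norm_num))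
  have hmass0 : 0 ≤ ((η * L)⁻¹) ^ 2 * ‖lam‖ ^ 2 := by positivity
  have hγ0 : 0 ≤ 1 / (3 + 4 / a') := by positivity
  have hk : (1 - (8 * d ^ 3 * A ^ 2 + 4 * (2 * d ^ 2 * A * Real.exp (2 * d ^ 2 * A)) ^ 2)) * (((η * L)⁻¹) ^ 2 * ‖lam‖ ^ 2) ≤
      (1 - (2 * d * (((L : ℝ) - 1) * L) * ε ^ 2 + 4 * ((1 + ε) ^ (d * (L - 1)) - 1) ^ 2)) * (((η * L)⁻¹) ^ 2 * ‖lam‖ ^ 2) :=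
    mul_le_mul_of_nonneg_right (by linarith [hκ]) hmass0
  refine le_trans (mul_le_mul_of_nonneg_left ?_ hγ0) hmain
  linarith [hk]
include hMφ hMφ' hφ hφ' hτφ htr hm hU hUstar hδ0 hδ hη ha' hηL0 hs in
/-- **THE WEAK (`L²`) FORM**: under the same hypotheses, `(1∕(3 + 4∕a′))·(1 − κ₀)·(ηL)⁻²·‖λ‖² ≤ re⟨λ, Δ′_{a′}(U)λ⟩` — the `‖D_Uλ‖²` row dropped; the
shape of the chain's `γ‖λ‖² ≤ re⟨λ, Δ′λ⟩` coercivity slots, now at the plaquette class with an η-, m-, L-free `γ` (positive as soon as `κ₀ < 1`).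
[cite: Balaban1985BackgroundPropagators, p.395, Thm 3.11 p.416, (3.35) p.396] -/
theorem site_coercive_of_small_plaquettes_canonical (hηL1 : η * L ≤ 1) {α₀ : ℝ} (hα₀ : 0 ≤ α₀) (hδα : δ ≤ α₀ * η ^ 2)
    (lam : SiteL2K ℂ d (fineP L m) c₀ W) :
    (1 / (3 + 4 / a')) * (1 - (8 * d ^ 3 * (Mφ * Mφ' * α₀) ^ 2 +
          4 * (2 * d ^ 2 * (Mφ * Mφ' * α₀) * Real.exp (2 * d ^ 2 * (Mφ * Mφ' * α₀))) ^ 2)) * (((η * L)⁻¹) ^ 2 * ‖lam‖ ^ 2) ≤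
      RCLike.re ⟪lam, laplacePrimeA L m φ η U a' (c₁ := c₁) lam⟫_ℂ := by
  have h := site_strong_coercive_of_small_plaquettes_canonical L m φ (c₁ := c₁) τ hMφ hMφ' hφ hφ' hτφ htr hm hU hUstar hδ0 hδ hη ha' hηL0 hs
    hηL1 hα₀ hδα lam
  have hγ0 : 0 ≤ 1 / (3 + 4 / a') := by positivity
  have hD0 : 0 ≤ ‖covDerivL2K ℂ c₀ ((η : ℂ))⁻¹ (adTransportW φ U) lam‖ ^ 2 := by positivity
  nlinarith [mul_nonneg hγ0 hD0]
include hMφ hMφ' hφ hφ' hτφ htr hm hU hUstar hδ0 hδ hη ha' hηL0 hs in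
/-- **THE `hpos′` SLOT OF THE CHAIN AT THE PLAQUETTE CLASS**: if `κ₀ < 1` (a smallness condition on `α₀` through `A = M_φM_φ′α₀` ONLY — no `η`, `m`, `L`),
then `0 < re⟨λ, Δ′_{a′}(U)λ⟩` for every `λ ≠ 0`: Thm 3.11's «Δ′_a … positive definite», so `G′ = (Δ′_{a′}(U))⁻¹` (3.25) exists at every `U` of
the class — the hypothesis `hpos′` of `B9Eq348QGGQLowerOfRightInverse` ∕ `B9Eq325ProjFormula`'s consumers, discharged. [cite: Balaban1985BackgroundPropagators, (3.25) p.394, p.395, Thm 3.11 p.416] -/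
theorem laplacePrimeA_pos_of_small_plaquettes (hηL1 : η * L ≤ 1) {α₀ : ℝ} (hα₀ : 0 ≤ α₀) (hδα : δ ≤ α₀ * η ^ 2)
    (hκ₀ : 8 * d ^ 3 * (Mφ * Mφ' * α₀) ^ 2 + 4 * (2 * d ^ 2 * (Mφ * Mφ' * α₀) * Real.exp (2 * d ^ 2 * (Mφ * Mφ' * α₀))) ^ 2 < 1)
    (lam : SiteL2K ℂ d (fineP L m) c₀ W) (hlam : lam ≠ 0) :
    0 < RCLike.re ⟪lam, laplacePrimeA L m φ η U a' (c₁ := c₁) lam⟫_ℂ := by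
  have h := site_coercive_of_small_plaquettes_canonical L m φ (c₁ := c₁) τ hMφ hMφ' hφ hφ' hτφ htr hm hU hUstar hδ0 hδ hη ha' hηL0 hs
    hηL1 hα₀ hδα lam
  have hγ : 0 < 1 / (3 + 4 / a') := by positivity
  have hn : 0 < ‖lam‖ ^ 2 := by positivity
  have ht : 0 < ((η * L)⁻¹) ^ 2 := by positivity
  have hpos : 0 < (1 / (3 + 4 / a')) * (1 - (8 * d ^ 3 * (Mφ * Mφ' * α₀) ^ 2 +
      4 * (2 * d ^ 2 * (Mφ * Mφ' * α₀) * Real.exp (2 * d ^ 2 * (Mφ * Mφ' * α₀))) ^ 2)) * (((η * L)⁻¹) ^ 2 * ‖lam‖ ^ 2) :=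
    mul_pos (mul_pos hγ (by linarith)) (mul_pos ht hn)
  exact hpos.trans_le h
set_option maxHeartbeats 400000 in
include hMφ hMφ' hφ hφ' hτφ htr ha' in
/-- **THE (SC) QUANTIFIER SHAPE — `∃ A₁ γ > 0` BEFORE `∀ L ∀ m ∀ U ∀ δ ∀ η ∀ c₀ c₁ ∀ α₀`**: there are `A₁(d) > 0` and `γ(a′) = 1∕(2(3 + 4∕a′)) > 0` such that
on EVERY lattice `T_{L·m}` (`2 ≤ m_i`), for EVERY unit-bounded unitary `U` with `‖U(∂p) − 1‖ ≤ δ ≤ α₀η²`, `M_φM_φ′α₀ ≤ A₁`, along `c₁(ηL)² = c₀L^d`,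
`0 < ηL ≤ 1`: `γ·(‖D_Uλ‖² + (ηL)⁻²‖λ‖²) ≤ re⟨λ, Δ′_{a′}(U)λ⟩` — the canonical theorem with `κ₀(A) ≤ A·(8d³ + 16e·d⁴ + 1) ≤ 1∕2` for
`A = M_φM_φ′α₀ ≤ A₁ := min (1∕(4d² + 1)) (1∕(2(8d³ + 16e·d⁴ + 1)))` (v1.4: `e^{4d²A} ≤ e` on `A ≤ 1∕(4d²+1)`; `≈ 4·10⁻⁵` at `d = 4`).  [B9] Thm 3.11 ∕ p. 395 for the site operator at print's class (3.35), uniformly in the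
lattice. [cite: Balaban1985BackgroundPropagators, p.395, (3.35) p.396, Thm 3.11 p.416; Balaban1987RG1, (1.11)–(1.12) p.262] -/
theorem exists_site_strong_coercive_of_small_plaquettes :
    ∃ A₁ γ : ℝ, 0 < A₁ ∧ 0 < γ ∧
      ∀ (L : ℕ) [NeZero L] (m : Fin d → ℕ) [∀ i, NeZero (fineP L m i)], (∀ i, 2 ≤ m i) →
      ∀ (U : Bond d (fineP L m) → 𝔸ˣ), (∀ b, U b ∈ U1 𝔸) → (∀ b, star (U b : 𝔸) = (((U b)⁻¹ : 𝔸ˣ) : 𝔸)) →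
      ∀ (δ : ℝ), 0 ≤ δ → (∀ p : B9SectCLatticeCarrier.Plaq d (fineP L m), ‖(plaqHolU U p : 𝔸) - 1‖ ≤ δ) →
      ∀ (η : ℝ), 0 < η * L → η * L ≤ 1 →
      ∀ (c₀ c₁ : ℝ) [Fact (0 < c₀)] [Fact (0 < c₁)], c₁ * (η * L) ^ 2 = c₀ * (L : ℝ) ^ d →
      ∀ (α₀ : ℝ), 0 ≤ α₀ → δ ≤ α₀ * η ^ 2 → Mφ * Mφ' * α₀ ≤ A₁ →
      ∀ lam : SiteL2K ℂ d (fineP L m) c₀ W,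
        γ * (‖covDerivL2K ℂ c₀ ((η : ℂ))⁻¹ (adTransportW φ U) lam‖ ^ 2 + ((η * L)⁻¹) ^ 2 * ‖lam‖ ^ 2) ≤
          RCLike.re ⟪lam, laplacePrimeA L m φ η U a' (c₁ := c₁) lam⟫_ℂ := by
  set Cd : ℝ := 8 * (d : ℝ) ^ 3 + 16 * (d : ℝ) ^ 4 * Real.exp 1 + 1 with hCd
  have hCd0 : 0 < Cd := by rw [hCd]; positivity
  refine ⟨min (1 / (4 * (d : ℝ) ^ 2 + 1)) (1 / (2 * Cd)), 1 / (2 * (3 + 4 / a')), lt_min (by positivity) (by positivity), by positivity, ?_⟩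
  intro L _ m _ hm U hU hUstar δ hδ0 hδ η hηL0 hηL1 c₀ c₁ _ _ hs α₀ hα₀ hδα hA lam
  have hη : η ≠ 0 := by rintro rfl; simp at hηL0
  have hmain := site_strong_coercive_of_small_plaquettes_canonical L m φ (c₁ := c₁) τ hMφ hMφ' hφ hφ' hτφ htr hm hU hUstar hδ0 hδ
    hη ha' hηL0 hs hηL1 hα₀ hδα lam
  set A := Mφ * Mφ' * α₀ with hAdef
  set Dn := ‖covDerivL2K ℂ c₀ ((η : ℂ))⁻¹ (adTransportW φ U) lam‖ ^ 2 with hDn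
  set Mn := ((η * L)⁻¹) ^ 2 * ‖lam‖ ^ 2 with hMn
  set K0 := 8 * (d : ℝ) ^ 3 * A ^ 2 + 4 * (2 * (d : ℝ) ^ 2 * A * Real.exp (2 * (d : ℝ) ^ 2 * A)) ^ 2 with hK0
  have hA0 : 0 ≤ A := mul_nonneg (mul_nonneg hMφ hMφ') hα₀
  have hd0 : (0 : ℝ) ≤ (d : ℝ) := Nat.cast_nonneg d
  have hA1' : A ≤ 1 / (4 * (d : ℝ) ^ 2 + 1) := hA.trans (min_le_left _ _)
  have hA1 : A ≤ 1 := hA1'.trans (by rw [div_le_one (by positivity)]; nlinarith [sq_nonneg (d : ℝ)])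
  have hA2 : A ≤ 1 / (2 * Cd) := hA.trans (min_le_right _ _)
  have hexp : Real.exp (4 * (d : ℝ) ^ 2 * A) ≤ Real.exp 1 := by
    refine Real.exp_le_exp.2 ?_
    have h := mul_le_mul_of_nonneg_left hA1' (show (0 : ℝ) ≤ 4 * (d : ℝ) ^ 2 by positivity)
    have e : 4 * (d : ℝ) ^ 2 * (1 / (4 * (d : ℝ) ^ 2 + 1)) ≤ 1 := by
      rw [mul_one_div, div_le_one (by positivity)]; linarith
    exact h.trans e
  have hsq : (2 * (d : ℝ) ^ 2 * A * Real.exp (2 * (d : ℝ) ^ 2 * A)) ^ 2 = 4 * (d : ℝ) ^ 4 * A ^ 2 * Real.exp (4 * (d : ℝ) ^ 2 * A) := by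
    have e2 : Real.exp (2 * (d : ℝ) ^ 2 * A) ^ 2 = Real.exp (4 * (d : ℝ) ^ 2 * A) := by
      rw [sq, ← Real.exp_add]; ring_nf
    rw [mul_pow, mul_pow, mul_pow, e2]; ring
  have hκ : K0 ≤ A * Cd := by
    rw [hK0, hsq, hCd]
    have hAA : A ^ 2 ≤ A := by nlinarith
    have h1 : 8 * (d : ℝ) ^ 3 * A ^ 2 ≤ 8 * (d : ℝ) ^ 3 * A := mul_le_mul_of_nonneg_left hAA (by positivity)
    have h3 : A ^ 2 * Real.exp (4 * (d : ℝ) ^ 2 * A) ≤ A * Real.exp 1 :=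
      mul_le_mul hAA hexp (by positivity) hA0
    have h2 : 4 * (4 * (d : ℝ) ^ 4 * A ^ 2 * Real.exp (4 * (d : ℝ) ^ 2 * A)) ≤ 16 * (d : ℝ) ^ 4 * (A * Real.exp 1) := by
      have h4 : 0 ≤ 16 * (d : ℝ) ^ 4 := by positivity
      calc 4 * (4 * (d : ℝ) ^ 4 * A ^ 2 * Real.exp (4 * (d : ℝ) ^ 2 * A)) = 16 * (d : ℝ) ^ 4 * (A ^ 2 * Real.exp (4 * (d : ℝ) ^ 2 * A)) := by ring
        _ ≤ 16 * (d : ℝ) ^ 4 * (A * Real.exp 1) := mul_le_mul_of_nonneg_left h3 h4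
    linarith [h1, h2]
  have hκ2 : A * Cd ≤ 1 / 2 := by
    calc A * Cd ≤ 1 / (2 * Cd) * Cd := mul_le_mul_of_nonneg_right hA2 hCd0.le
      _ = 1 / 2 := by field_simp
  have hM0 : 0 ≤ Mn := by rw [hMn]; positivity
  have hγ0 : 0 < 1 / (3 + 4 / a') := by positivity
  have hhalf : (1 : ℝ) / 2 ≤ 1 - K0 := by linarith
  have h2 : 1 / 2 * (Dn + Mn) ≤ Dn + (1 - K0) * Mn := by nlinarith [mul_le_mul_of_nonneg_right hhalf hM0]
  have e : 1 / (2 * (3 + 4 / a')) = (1 / (3 + 4 / a')) * (1 / 2) := by field_simp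
  rw [e, mul_assoc]
  exact (mul_le_mul_of_nonneg_left h2 hγ0.le).trans hmain

end Thm311

end Literature.MathematicalPhysics.QuantumFieldTheory.Balaban1983to89.B9Thm311SitePrimeFormCoercivePlaquette

end
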